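import Summits.BirchSwinnertonDyer.BirchSwinnertonDyer.Theorems.ResidualThetaTransportAtTwoSignedMuVanishingAtTwoPlusCuspSpanFlat
import Literature.NumberTheory.EllipticCurves.ModularSymbolsParabolicCohomology
import HarnessLib

/-!
# Route `ResidualThetaTransportAtTwo`, crux Kμ⁺ `SignedMuVanishingAtTwoPlus` (stmt-BirchSwinnertonDyer-20689),
# line `birth`, stub `stub_flatMuZeroAtTwo`: the ANALYSIS-FREE form (G″)_N of the spanning hypothesis (G′)_N —
# a statement about the group `Γ₀(N)` alone — implies (G′)_N, hence FLAT

Cell `bsd-wall`, width seat `bsd-wall-rtt-p4-w3` (g3). THEOREMS ONLY (no `def`, no named fact, no `sorry`); helper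
`--supports` the crux; (G″)_N / (G′)_N are HYPOTHESES, spelled inline; BSD is not proved by this.

Lead g5's `flatAtTwo_of_cuspSpan` (`…CuspSpanFlat`, p593268) derives FLAT at `(W, f)` from the DUAL form (G′)_{N_W} of
lead g4's spanning statement: every additive `χ : Γ₀(N) → ZMod 2` which FACTORS THROUGH THE PERIOD HOMOLOGY
(`periodFunctional N γ = periodFunctional N δ ⟹ χ γ = χ δ` — a condition referring to all weight-2 cusp forms) and
kills every `γ` with lower-right entry `±4^k`, `k ≥ 1`, is `ψ ∘ d`. This file removes the cusp forms from the
hypothesis: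

* §1 `periodFunctional_eq_zero_of_natAbs_trace_le_two` — for `γ ∈ Γ₀(N)` with `|tr γ| ≤ 2` the period functional
  `h ↦ {∞, γ∞}_h` is ZERO: `|tr γ| = 2` (`±1`, parabolic) is the tree's `cuspSymbol_eq_zero_of_discr_eq_zero`
  (Knapp Prop. 11.1); `|tr γ| ≤ 1` (elliptic) gives `γ¹² = 1` (Cayley–Hamilton, `pow_twelve_eq_one_of_natAbs_trace_le_one`)
  and `12 · {∞, γ∞} = {∞, γ¹²∞} = 0` in the torsion-free group `S₂(Γ₀(N))^∧`.
* §2 `cuspSpan_of_cuspSpanTrace` — **(G″)_N ⟹ (G′)_N**, where (G″)_N (inline): every additive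
  `χ : Γ₀(N) → ZMod 2` that kills every `γ` with `|tr γ| ≤ 2` and every `γ` with `|d(γ)| = 4^k` (`k ≥ 1`) is `ψ ∘ d`
  with `ψ : ZMod N → ZMod 2` multiplicative on units. (G″)_N mentions only `Γ₀(N) ⊂ SL(2, ℤ)`: it says that the
  `𝔽₂`-characters of `π₁(X₀(N)) = Γ₀(N)/⟨±1, elliptic, parabolic⟩` killing the loops `{0 → b/4^k}` come from the
  Shimura covering — the group-theoretic statement that lead g4's `cuspspan*.py` verified by Manin symbols for all
  odd `N ≤ 2999` (`FlatCuspSpan.md` §4); it is equivalent to (G′)_N granted Eichler–Shimura (`H₁(X₀(N); ℤ) ↪ S₂^∧`),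
  which is NOT used here (only the trivial direction (G″) ⟹ (G′) is).
* §3 `flatAtTwo_of_cuspSpanTrace`, `flatMuZeroAtTwo_of_cuspSpanTrace`,
  `signedMuAnalyticAtTwoPlus_of_abbesUllmo_of_cuspSpanTrace` — the compositions with p593268: (G″)_{N_W} ⟹ `2 ∤ L♭`
  for every Pollack pair of the habitat⁺ newform; (G″)_N for all odd `N` ⟹ the registered stub `FlatMuZeroAtTwo`
  (verbatim) and, with Abbes–Ullmo by name, the analytic child 21437.
* §4 `cuspSpanTrace_of_generators` — the per-level certificate hook: if `S` generates `Γ₀(N)`, (G″)_N holds as soon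
  as every such `χ` agrees with some `ψ ∘ d` ON `S` (both sides are homomorphisms; `d` is `Gamma0Map`).

References: A. W. Knapp, *Elliptic curves* (1992) Prop. 11.1, Prop. 11.22 [Knapp1993]; G. Shimura, *Introduction to
the arithmetic theory of automorphic functions* (1971) §1.2, §8.1–8.2 [ShimuraIATAF1971]; R. Pollack, Duke Math. J.
118 (2003) Conj. 6.3, Prop. 6.18 [Pollack2003]; J. E. Cremona, *Algorithms for modular elliptic curves* (1997) §2.1,
§2.8 [CremonaAlgorithms1997].
-/

set_option autoImplicit false
set_option linter.dupNamespace false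

noncomputable section

open scoped Classical MatrixGroups ModularForm

open CongruenceSubgroup WeierstrassCurve Literature.NumberTheory.EllipticCurves
  Literature.NumberTheory.EllipticCurves.ModularForms Literature.NumberTheory.EllipticCurves.Rank1Residual
  Literature.NumberTheory.IwasawaTheory Summit.BirchSwinnertonDyer.Rank1Residual.Supersingular
  Summit.BirchSwinnertonDyer.BirchSwinnertonDyer.Theses.ResidualThetaTransportAtTwo

namespace Summit.BirchSwinnertonDyer.BirchSwinnertonDyer.Theorems.SignedMuAtTwo

/-! ## §1. Period functionals vanish on `±1`, elliptic and parabolic elements (`|tr γ| ≤ 2`) -/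

section SmallTrace

/-- **Cayley–Hamilton in `SL(2, ℤ)`**: `γ² = (tr γ)·γ − 1` as integral matrices (the scalar action is written
`HSMul.hSMul` to keep the elaborator from coercing the trace to a scalar matrix). [folklore] -/
theorem sl_two_mul_self_eq (γ : SL(2, ℤ)) :
    ((γ : Matrix (Fin 2) (Fin 2) ℤ) * (γ : Matrix (Fin 2) (Fin 2) ℤ)) =
      HSMul.hSMul (γ 0 0 + γ 1 1 : ℤ) (γ : Matrix (Fin 2) (Fin 2) ℤ) - 1 := by
  have hdet : γ 0 0 * γ 1 1 - γ 0 1 * γ 1 0 = 1 := by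
    have := Matrix.SpecialLinearGroup.det_coe γ
    rwa [Matrix.det_fin_two] at this
  ext i j
  fin_cases i <;> fin_cases j <;>
    simp [Matrix.mul_apply, Fin.sum_univ_two, -zsmul_eq_mul, Matrix.smul_apply] <;>
    first | linear_combination (-1 : ℤ) * hdet | ring
    
/-- **Elliptic elements of `SL(2, ℤ)` have order dividing `12`**: if `|tr γ| ≤ 1` then `γ¹² = 1` (`tr γ = 0`:
`γ² = −1`; `tr γ = ±1`: `γ³ = ∓1`; Cayley–Hamilton). [cite: ShimuraIATAF1971, §1.2 (elliptic elements)] -/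
theorem pow_twelve_eq_one_of_natAbs_trace_le_one (γ : SL(2, ℤ)) (h : (γ 0 0 + γ 1 1).natAbs ≤ 1) :
    γ ^ 12 = 1 := by
  have ht : (γ 0 0 + γ 1 1 : ℤ) = 0 ∨ (γ 0 0 + γ 1 1 : ℤ) = 1 ∨ (γ 0 0 + γ 1 1 : ℤ) = -1 := by omega
  have h2 := sl_two_mul_self_eq γ
  -- it suffices to prove the matrix identity
  suffices hM12 : (γ : Matrix (Fin 2) (Fin 2) ℤ) ^ 12 = 1 by
    apply Subtype.ext
    rw [Matrix.SpecialLinearGroup.coe_pow, Matrix.SpecialLinearGroup.coe_one]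
    exact hM12
  rcases ht with ht | ht | ht
  · -- `γ² = -1`
    rw [ht, zero_smul, zero_sub] at h2
    have h4 : (γ : Matrix (Fin 2) (Fin 2) ℤ) ^ 4 = 1 := by
      rw [show (4 : ℕ) = 2 + 2 by norm_num, pow_add, pow_two, h2, neg_mul_neg, one_mul]
    rw [show (12 : ℕ) = 4 * 3 by norm_num, pow_mul, h4, one_pow]
  · -- `γ² = γ - 1`, `γ³ = -1`
    rw [ht, one_smul] at h2
    have h3 : (γ : Matrix (Fin 2) (Fin 2) ℤ) ^ 3 = -1 := by
      rw [pow_succ, pow_two, h2, sub_mul, h2, one_mul, sub_sub_cancel_left]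
    rw [show (12 : ℕ) = 3 * 4 by norm_num, pow_mul, h3]
    norm_num
  · -- `γ² = -γ - 1`, `γ³ = 1`
    rw [ht, neg_one_smul] at h2
    have h3 : (γ : Matrix (Fin 2) (Fin 2) ℤ) ^ 3 = 1 := by
      rw [pow_succ, pow_two, h2, sub_mul, neg_mul, h2, one_mul]
      abel
    rw [show (12 : ℕ) = 3 * 4 by norm_num, pow_mul, h3, one_pow]

variable {N : ℕ} [NeZero N]

/-- The period functional of a power: `{∞, γⁿ∞} = n · {∞, γ∞}` (Manin's homomorphism property).
[cite: Manin1972, Prop. 1.4] -/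
theorem periodFunctional_pow (γ : Gamma0 N) (n : ℕ) :
    periodFunctional N (γ ^ n) = n • periodFunctional N γ := by
  induction n with
  | zero => simp
  | succ n ih => rw [pow_succ, periodFunctional_mul, ih, succ_nsmul]

/-- **Period functionals vanish on elements of small trace.** For `γ ∈ Γ₀(N)` with `|tr γ| ≤ 2` — i.e. `γ = ±1`,
`γ` elliptic (`|tr γ| ≤ 1`, finite order) or `γ` parabolic (`|tr γ| = 2`, fixing a cusp) — the functional
`h ↦ {∞, γ∞}_h` on `S₂(Γ₀(N))` is zero: the parabolic/scalar case is the tree's `cuspSymbol_eq_zero_of_discr_eq_zero`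
(discriminant `tr² − 4 = 0`), the elliptic case follows from `γ¹² = 1` and `12 · {∞, γ∞} = {∞, γ¹²∞} = 0` in the
complex vector space `S₂(Γ₀(N))^∧`. [cite: Knapp1993, Prop. 11.1] [cite: ShimuraIATAF1971, §8.1 (8.1.4), §1.2] -/
theorem periodFunctional_eq_zero_of_natAbs_trace_le_two (γ : Gamma0 N)
    (h : ((γ : SL(2, ℤ)) 0 0 + (γ : SL(2, ℤ)) 1 1).natAbs ≤ 2) : periodFunctional N γ = 0 := by
  rcases Nat.lt_or_ge ((( γ : SL(2, ℤ)) 0 0 + (γ : SL(2, ℤ)) 1 1).natAbs) 2 with hlt | hge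
  · -- elliptic: `γ¹² = 1`
    have h12 : (γ : SL(2, ℤ)) ^ 12 = 1 := pow_twelve_eq_one_of_natAbs_trace_le_one _ (by omega)
    have hγ12 : γ ^ 12 = 1 := by
      apply Subtype.ext
      rw [SubgroupClass.coe_pow]
      exact h12
    have hsm : (12 : ℕ) • periodFunctional N γ = 0 := by
      rw [← periodFunctional_pow, hγ12, periodFunctional_one]
    rw [← Nat.cast_smul_eq_nsmul ℂ] at hsm
    exact (smul_eq_zero.mp hsm).resolve_left (by norm_num)
  · -- scalar or parabolic: discriminant zero
    have heq : ((γ : SL(2, ℤ)) 0 0 + (γ : SL(2, ℤ)) 1 1).natAbs = 2 := le_antisymm h hge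
    have hsq : ((γ : SL(2, ℤ)) 0 0 + (γ : SL(2, ℤ)) 1 1) ^ 2 = 4 := by
      have := Int.natAbs_eq_iff_sq_eq.mp (show ((γ : SL(2, ℤ)) 0 0 + (γ : SL(2, ℤ)) 1 1).natAbs =
        (2 : ℤ).natAbs by rw [heq]; rfl)
      rw [this]; norm_num
    have hdiscr : ((γ : SL(2, ℤ)) : Matrix (Fin 2) (Fin 2) ℤ).discr = 0 := by
      rw [Matrix.discr_fin_two, Matrix.trace_fin_two, Matrix.SpecialLinearGroup.det_coe]
      change ((γ : SL(2, ℤ)) 0 0 + (γ : SL(2, ℤ)) 1 1) ^ 2 - 4 * 1 = 0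
      rw [hsq]; norm_num
    ext f
    exact cuspSymbol_eq_zero_of_discr_eq_zero f hdiscr

end SmallTrace

/-! ## §2. (G″)_N (trace form, Γ₀(N) only) ⟹ (G′)_N (period form) -/

section TraceForm

variable {N : ℕ} [NeZero N]

/-- **(G″)_N ⟹ (G′)_N.** The ANALYSIS-FREE spanning hypothesis (G″)_N — every additive `χ : Γ₀(N) → ZMod 2`
killing all `γ` with `|tr γ| ≤ 2` (`±1`, elliptic, parabolic: `χ ∈ H¹(X₀(N); 𝔽₂) = Hom(π₁ X₀(N), 𝔽₂)`) and all `γ`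
with `|d(γ)| = 4^k`, `k ≥ 1` (the loops `{0 → b/4^k}`), is `ψ ∘ d` with `ψ : ZMod N → ZMod 2` multiplicative on
units — implies the dual/period form (G′)_N used by `exists_odd_re_cuspSymbol_of_cuspSpan` and
`flatAtTwo_of_cuspSpan` (χ factoring through `periodFunctional`): a `χ` factoring through the period functionals
kills every small-trace `γ`, because their period functionals vanish (§1). (The converse, (G′) ⟹ (G″), is
Eichler–Shimura injectivity and is not needed.) [cite: Knapp1993, Prop. 11.1, Prop. 11.22] [cite: Pollack2003, Conj. 6.3] -/
theorem cuspSpan_of_cuspSpanTrace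
    (hG : ∀ χ : Gamma0 N → ZMod 2,
      (∀ γ δ : Gamma0 N, χ (γ * δ) = χ γ + χ δ) →
      (∀ γ : Gamma0 N, ((γ : SL(2, ℤ)) 0 0 + (γ : SL(2, ℤ)) 1 1).natAbs ≤ 2 → χ γ = 0) →
      (∀ γ : Gamma0 N, (∃ k : ℕ, 1 ≤ k ∧ ((γ : SL(2, ℤ)) 1 1).natAbs = 4 ^ k) → χ γ = 0) →
      ∃ ψ : ZMod N → ZMod 2, (∀ x y : ZMod N, IsUnit x → IsUnit y → ψ (x * y) = ψ x + ψ y) ∧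
        ∀ γ : Gamma0 N, χ γ = ψ ((((γ : SL(2, ℤ)) 1 1 : ℤ) : ZMod N))) :
    ∀ χ : Gamma0 N → ZMod 2,
      (∀ γ δ : Gamma0 N, χ (γ * δ) = χ γ + χ δ) →
      (∀ γ δ : Gamma0 N, periodFunctional N γ = periodFunctional N δ → χ γ = χ δ) →
      (∀ γ : Gamma0 N, (∃ k : ℕ, 1 ≤ k ∧ ((γ : SL(2, ℤ)) 1 1).natAbs = 4 ^ k) → χ γ = 0) →
      ∃ ψ : ZMod N → ZMod 2, (∀ x y : ZMod N, IsUnit x → IsUnit y → ψ (x * y) = ψ x + ψ y) ∧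
        ∀ γ : Gamma0 N, χ γ = ψ ((((γ : SL(2, ℤ)) 1 1 : ℤ) : ZMod N)) := by
  intro χ hadd hfac hkill
  refine hG χ hadd (fun γ hγ ↦ ?_) hkill
  have h1 : χ 1 = 0 := by
    have h := hadd 1 1
    rw [mul_one] at h
    -- `x = x + x` in `ZMod 2` forces `x = 0`
    have h2 : χ 1 + χ 1 = 0 := by
      rw [← two_mul]; exact mul_eq_zero_of_left (by decide) _
    rw [← h2, ← h]
  rw [hfac γ 1 (by rw [periodFunctional_eq_zero_of_natAbs_trace_le_two γ hγ, periodFunctional_one]), h1]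

end TraceForm

/-! ## §3. (G″) ⟹ FLAT on the habitat⁺; (G″) for all odd `N` ⟹ the registered stub and the analytic child -/

section Flat

variable {W : WeierstrassCurve ℚ} [W.IsElliptic] [W.IsGloballyMinimal]

/-- **(G″)_{N_W} ⟹ FLAT at `(W, f)`.** For `W/ℚ` good supersingular at `2` with `a₂(W) = 0` and its newform `f`
(odd level `N_W`): the analysis-free spanning hypothesis (G″)_{N_W} — a statement about the group `Γ₀(N_W)` only —
implies `2 ∤ L♭` for every Pollack pair `(L♯, L♭)` of `f` at `2` (§2 then lead g5's `flatAtTwo_of_cuspSpan`: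
Hecke–Shimura, the odd doubled plus period on a `4^k`-class, the half-integral `[5^s/2^{n+2}]⁺_f`, door p578368).
(G″)_{N_W} is a hypothesis; BSD is not proved by this. [cite: Pollack2003, Conj. 6.3 and Prop. 6.18] [cite: Knapp1993, Prop. 11.1] -/
theorem flatAtTwo_of_cuspSpanTrace [NeZero (W.conductorNorm ℤ)] {f : CuspForm (Gamma0 (W.conductorNorm ℤ)) 2}
    (hf : IsNewformOf W f) (hss : GoodSS W 2) (ha : W.frobeniusTrace 2 = 0)
    (hG : ∀ χ : Gamma0 (W.conductorNorm ℤ) → ZMod 2,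
      (∀ γ δ : Gamma0 (W.conductorNorm ℤ), χ (γ * δ) = χ γ + χ δ) →
      (∀ γ : Gamma0 (W.conductorNorm ℤ), ((γ : SL(2, ℤ)) 0 0 + (γ : SL(2, ℤ)) 1 1).natAbs ≤ 2 → χ γ = 0) →
      (∀ γ : Gamma0 (W.conductorNorm ℤ), (∃ k : ℕ, 1 ≤ k ∧ ((γ : SL(2, ℤ)) 1 1).natAbs = 4 ^ k) → χ γ = 0) →
      ∃ ψ : ZMod (W.conductorNorm ℤ) → ZMod 2,
        (∀ x y : ZMod (W.conductorNorm ℤ), IsUnit x → IsUnit y → ψ (x * y) = ψ x + ψ y) ∧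
        ∀ γ : Gamma0 (W.conductorNorm ℤ), χ γ = ψ ((((γ : SL(2, ℤ)) 1 1 : ℤ) : ZMod (W.conductorNorm ℤ)))) :
    ∀ Lplus Lminus : IwasawaAlgebra 2, IsPollackPair f 2 Lplus Lminus → ¬ PowerSeries.C (2 : ℤ_[2]) ∣ Lminus :=
  flatAtTwo_of_cuspSpan hf hss ha (cuspSpan_of_cuspSpanTrace hG)

/-- **(G″)_N for every odd `N` ⟹ the registered stub `FlatMuZeroAtTwo` of line `birth`** (verbatim: on the
habitat⁺, `2 ∤ L♭` for every Pollack pair of the newform at `2`). The hypothesis is a statement about the groups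
`Γ₀(N)`, `N` odd, and nothing else. BSD is not proved by this. [cite: Pollack2003, Conj. 6.3 and Prop. 6.18] -/
theorem flatMuZeroAtTwo_of_cuspSpanTrace
    (hG : ∀ (N : ℕ) [NeZero N], ¬ 2 ∣ N → ∀ χ : Gamma0 N → ZMod 2,
      (∀ γ δ : Gamma0 N, χ (γ * δ) = χ γ + χ δ) →
      (∀ γ : Gamma0 N, ((γ : SL(2, ℤ)) 0 0 + (γ : SL(2, ℤ)) 1 1).natAbs ≤ 2 → χ γ = 0) →
      (∀ γ : Gamma0 N, (∃ k : ℕ, 1 ≤ k ∧ ((γ : SL(2, ℤ)) 1 1).natAbs = 4 ^ k) → χ γ = 0) →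
      ∃ ψ : ZMod N → ZMod 2, (∀ x y : ZMod N, IsUnit x → IsUnit y → ψ (x * y) = ψ x + ψ y) ∧
        ∀ γ : Gamma0 N, χ γ = ψ ((((γ : SL(2, ℤ)) 1 1 : ℤ) : ZMod N))) :
    ∀ (W : WeierstrassCurve ℚ) [W.IsElliptic] [W.IsGloballyMinimal], ¬ W.HasCM → W.analyticRank = 0 →
      GoodSS W 2 → W.frobeniusTrace 2 = 0 → W.Δ < 0 →
      ∀ [NeZero (W.conductorNorm ℤ)] (f : CuspForm (Gamma0 (W.conductorNorm ℤ)) 2), IsNewformOf W f →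
      ∀ (Lplus Lminus : IwasawaAlgebra 2), IsPollackPair f 2 Lplus Lminus → ¬ PowerSeries.C (2 : ℤ_[2]) ∣ Lminus :=
  flatMuZeroAtTwo_of_cuspSpan fun N _ hN ↦ cuspSpan_of_cuspSpanTrace (hG N hN)

/-- **(G″)_N for every odd `N` ∧ Abbes–Ullmo Thm A (by name) ⟹ the analytic child 21437 `SignedMuAnalyticAtTwoPlus`.**
Conditional on the print fact `abbesUllmo_not_dvd_maninConstant_of_not_dvd_level` and on the group-theoretic
hypothesis (G″); BSD is not proved by this. [cite: AbbesUllmo1996, Thm. A] [cite: Pollack2003, Conj. 6.3 and Prop. 6.18] -/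
theorem signedMuAnalyticAtTwoPlus_of_abbesUllmo_of_cuspSpanTrace
    (hAU : abbesUllmo_not_dvd_maninConstant_of_not_dvd_level)
    (hG : ∀ (N : ℕ) [NeZero N], ¬ 2 ∣ N → ∀ χ : Gamma0 N → ZMod 2,
      (∀ γ δ : Gamma0 N, χ (γ * δ) = χ γ + χ δ) →
      (∀ γ : Gamma0 N, ((γ : SL(2, ℤ)) 0 0 + (γ : SL(2, ℤ)) 1 1).natAbs ≤ 2 → χ γ = 0) →
      (∀ γ : Gamma0 N, (∃ k : ℕ, 1 ≤ k ∧ ((γ : SL(2, ℤ)) 1 1).natAbs = 4 ^ k) → χ γ = 0) →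
      ∃ ψ : ZMod N → ZMod 2, (∀ x y : ZMod N, IsUnit x → IsUnit y → ψ (x * y) = ψ x + ψ y) ∧
        ∀ γ : Gamma0 N, χ γ = ψ ((((γ : SL(2, ℤ)) 1 1 : ℤ) : ZMod N))) :
    SignedMuAnalyticAtTwoPlus :=
  signedMuAnalyticAtTwoPlus_of_abbesUllmo_of_cuspSpan hAU fun N _ hN ↦ cuspSpan_of_cuspSpanTrace (hG N hN)

end Flat

/-! ## §4. The certificate hook: it suffices to match `ψ ∘ d` on a generating set of `Γ₀(N)` -/

section Generators

variable {N : ℕ}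

/-- `d(γδ) = d(γ) d(δ)` in `ZMod N` for `γ, δ ∈ Γ₀(N)` (`Gamma0Map` is a homomorphism). [folklore] -/
theorem cast_mul_apply_one_one (γ δ : Gamma0 N) :
    ((((γ * δ : Gamma0 N) : SL(2, ℤ)) 1 1 : ℤ) : ZMod N) =
      ((((γ : SL(2, ℤ)) 1 1 : ℤ) : ZMod N)) * ((((δ : SL(2, ℤ)) 1 1 : ℤ) : ZMod N)) :=
  map_mul (Gamma0Map N) γ δ

/-- `d(γ⁻¹) = a(γ)` for `γ ∈ Γ₀(N)` (adjugate). [folklore] -/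
theorem coe_inv_apply_one_one (γ : Gamma0 N) : ((γ⁻¹ : Gamma0 N) : SL(2, ℤ)) 1 1 = (γ : SL(2, ℤ)) 0 0 := by
  rw [InvMemClass.coe_inv, Matrix.SpecialLinearGroup.SL2_inv_expl]
  rfl

/-- For `ψ : ZMod N → ZMod 2` multiplicative on units: `ψ(a(γ)) = ψ(d(γ))` for `γ ∈ Γ₀(N)` (`d · a = 1`, values in
`ZMod 2`). [folklore] -/
theorem map_apply_zero_zero_eq_of_mul_on_units {ψ : ZMod N → ZMod 2}
    (hψ : ∀ x y : ZMod N, IsUnit x → IsUnit y → ψ (x * y) = ψ x + ψ y) (γ : Gamma0 N) :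
    ψ ((((γ : SL(2, ℤ)) 0 0 : ℤ) : ZMod N)) = ψ ((((γ : SL(2, ℤ)) 1 1 : ℤ) : ZMod N)) := by
  have hda := gamma0_apply_one_one_mul_apply_zero_zero γ
  have ha : IsUnit ((((γ : SL(2, ℤ)) 0 0 : ℤ) : ZMod N)) := IsUnit.of_mul_eq_one_right _ hda
  have h := hψ _ _ (isUnit_gamma0_apply_one_one γ) ha
  rw [hda, map_one_eq_zero_of_mul_on_units hψ] at h
  -- `0 = ψ d + ψ a` in `ZMod 2`
  have : ψ ((((γ : SL(2, ℤ)) 0 0 : ℤ) : ZMod N)) = -ψ ((((γ : SL(2, ℤ)) 1 1 : ℤ) : ZMod N)) := by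
    linear_combination (-1 : ZMod 2) * h
  rw [this, ZMod.neg_eq_self_mod_two]

/-- **Generator reduction (per-level certificate hook).** Let `S ⊆ Γ₀(N)` generate `Γ₀(N)`. If for every additive
`χ : Γ₀(N) → ZMod 2` killing the small-trace elements and the `4^k`-classes there is a `ψ : ZMod N → ZMod 2`,
multiplicative on units, with `χ s = ψ(d(s))` for all `s ∈ S`, then (G″)_N holds: `χ` and `ψ ∘ d` are both
homomorphisms (`d` is `Gamma0Map`), so they agree on the subgroup generated by `S`. [folklore] -/
theorem cuspSpanTrace_of_generators {S : Set (Gamma0 N)} (hS : Subgroup.closure S = ⊤)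
    (hG : ∀ χ : Gamma0 N → ZMod 2,
      (∀ γ δ : Gamma0 N, χ (γ * δ) = χ γ + χ δ) →
      (∀ γ : Gamma0 N, ((γ : SL(2, ℤ)) 0 0 + (γ : SL(2, ℤ)) 1 1).natAbs ≤ 2 → χ γ = 0) →
      (∀ γ : Gamma0 N, (∃ k : ℕ, 1 ≤ k ∧ ((γ : SL(2, ℤ)) 1 1).natAbs = 4 ^ k) → χ γ = 0) →
      ∃ ψ : ZMod N → ZMod 2, (∀ x y : ZMod N, IsUnit x → IsUnit y → ψ (x * y) = ψ x + ψ y) ∧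
        ∀ s ∈ S, χ s = ψ ((((s : SL(2, ℤ)) 1 1 : ℤ) : ZMod N))) :
    ∀ χ : Gamma0 N → ZMod 2,
      (∀ γ δ : Gamma0 N, χ (γ * δ) = χ γ + χ δ) →
      (∀ γ : Gamma0 N, ((γ : SL(2, ℤ)) 0 0 + (γ : SL(2, ℤ)) 1 1).natAbs ≤ 2 → χ γ = 0) →
      (∀ γ : Gamma0 N, (∃ k : ℕ, 1 ≤ k ∧ ((γ : SL(2, ℤ)) 1 1).natAbs = 4 ^ k) → χ γ = 0) →
      ∃ ψ : ZMod N → ZMod 2, (∀ x y : ZMod N, IsUnit x → IsUnit y → ψ (x * y) = ψ x + ψ y) ∧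
        ∀ γ : Gamma0 N, χ γ = ψ ((((γ : SL(2, ℤ)) 1 1 : ℤ) : ZMod N)) := by
  intro χ hadd hsmall hkill
  obtain ⟨ψ, hψ, hS'⟩ := hG χ hadd hsmall hkill
  refine ⟨ψ, hψ, fun γ ↦ ?_⟩
  have h1 : χ 1 = 0 := by
    have h := hadd 1 1
    rw [mul_one] at h
    linear_combination (-1 : ZMod 2) * h
  have hmem : γ ∈ Subgroup.closure S := by rw [hS]; exact Subgroup.mem_top γ
  induction hmem using Subgroup.closure_induction with
  | mem s hs => exact hS' s hs
  | one =>
    rw [h1, OneMemClass.coe_one, Matrix.SpecialLinearGroup.coe_one, Matrix.one_apply_eq, Int.cast_one,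
      map_one_eq_zero_of_mul_on_units hψ]
  | mul x y _ _ hx hy =>
    rw [hadd, hx, hy, cast_mul_apply_one_one,
      hψ _ _ (isUnit_gamma0_apply_one_one x) (isUnit_gamma0_apply_one_one y)]
  | inv x _ hx =>
    have hinv : χ x⁻¹ = χ x := by
      have h := hadd x x⁻¹
      rw [mul_inv_cancel, h1] at h
      have : χ x⁻¹ = -χ x := by linear_combination (-1 : ZMod 2) * h
      rw [this, ZMod.neg_eq_self_mod_two]
    rw [hinv, hx, coe_inv_apply_one_one, map_apply_zero_zero_eq_of_mul_on_units hψ]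

end Generators

end Summit.BirchSwinnertonDyer.BirchSwinnertonDyer.Theorems.SignedMuAtTwo

end
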